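/-
Origin: expansion seat `prover-pub-hodgecm-mc-binder-2-g11-0`, handover #40 2026-08-20T03:12Z md5 9b7774606acf (205 l.; CERTIFIED rc 0 / 0 warn / 24.6 s; imports RUN-37 `HypCensus/TorusChart` (#25), `HypCensus/ArchFactor`, unitary-1 `Model/WmInputInstance`; §1 `archGLn`, `map_fst_toAdeleGLn`, `inv_conj_mem_arch_of_congr` (any N, inverse direction of #25's Fin-2 lemma), **`archFrameConj L N H g d hg : U(H)(L⁺⊗ℝ) →* U(diag d)(L⁺⊗ℝ)`** (`k ↦ g⁻¹kg`), `continuous_archFrameConj`, **`cmKTypeHom_archToAdelic`** (`cmKTypeHom H g d hg (archToAdelic H k) = archToAdelic (diag d) (g⁻¹kg)`); §2 **`wmInputCM₂g_mem_SK_iff_arch`**: at the W pin of record, `Ψ ∈ W₀.SK ↔ ∀ k ∈ K_∞, W₀.ρ (archProdHom (frameG⁻¹ k frameG, 1)) Ψ = archKappa k • Ψ` — the (J-x₀) membership test in the input shape of the compact-letter ENGINE #32; NAME LIST `HodgeCM.Model.HypCensus.wmInputCM₂g_mem_SK_iff_arch`, `HodgeCM.Model.HypCensus.cmKTypeHom_archToAdelic`,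 `HodgeCM.Model.HypCensus.archFrameConj`; axioms trio) (`HOME/mc/pub-hodgecm-mc-binder-2/g11/pkg/HodgeCM/Model/HypCensus/ArchFrameConj.lean`, md5 9b7774606acf, 209 lines);
landed by the gen-14 packager (p-g14) in gate run 39 as `HodgeCM/Model/HypCensus/ArchFrameConj.lean` (verbatim).
-/
/-
Origin: speedrun cell pub-hodgecm, MODEL-CONSTRUCTION sub-cell, lineage mc-binder-2 (BINDER-OWNERS rows 18/19: E binders
`hyp12` / `hyp34` of `Model.perL_picardCM_r15A`), seat prover-pub-hodgecm-mc-binder-2-g11-0 (gen 11), 2026-08-20.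
Target in PKG: `HodgeCM/Model/HypCensus/ArchFrameConj.lean` (NEW additive leaf; imports binder-2-g9's `HypCensus/TorusChart` (RUN 37) and
unitary-1's `Model/WmInputInstance` (RUN 37)).  KERNEL ONLY: 0 records, nothing cited as hypothesis, 0 `def … : Prop`; two defs + lemmas.
-/
import Summits.HodgeConjecture.HodgeCM.Model.HypCensus.TorusChart
import Summits.HodgeConjecture.HodgeCM.Model.HypCensus.ArchFactor_2
import Summits.HodgeConjecture.HodgeCM.Model.WmInputInstance

/-!
# Census kit (rows A12/A34), junction (J-x₀) step (a): the frame transport of `K_∞` is archimedean conjugation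

The `wm` input of record tests membership in `𝒮^κ` through `ρ (eV (gK k), 1)` with `eV ∘ gK = cmKTypeHom (frameG-transport) ∘ archToAdelic`
(unitary-1 `wmInputCM₂g_mem_SK_iff`, `wmInputCM₂g_eV_archIsotropyRegime`).  This leaf identifies that element as the adelic image of an
ARCHIMEDEAN element of `U(diag d)(L⁺ ⊗ ℝ)` — the input currency of the compact-letter engine (`CompactLetters`):

* `archGLn L N g` — a rational `g ∈ GL_N(L)` read in `GL_N(L ⊗ ℝ)`; `map_fst_toAdeleGLn` — the archimedean part of `g_𝔸` is `g ⊗ 1`;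
* `inv_conj_mem_arch_of_congr` — `ᵗḡ J g = J'`, `x ∈ U(J)(L⁺ ⊗ ℝ)` ⇒ `g⁻¹ x g ∈ U(J')(L⁺ ⊗ ℝ)` (binder-2-g9's `conj_mem_arch_of_congr`, any `N`,
  inverse direction);
* **`archFrameConj L N H g d hg : U(H)(L⁺ ⊗ ℝ) →* U(diag d)(L⁺ ⊗ ℝ)`**, `k ↦ g⁻¹ k g`;
* **`cmKTypeHom_archToAdelic`**: `cmKTypeHom L H g d hg (archToAdelic H k) = archToAdelic (diag d) (archFrameConj … k)`;
* §2 **`wmInputCM₂g_mem_SK_iff_arch`** — at the W pin of record: `Ψ ∈ W₀.SK ↔ ∀ k ∈ K_∞, W₀.ρ (archProdHom (frameG⁻¹ k frameG, 1)) Ψ = κ(k) • Ψ`.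

Nothing here is a claim of PerL/QW8.  Style lint (L-notation): no `local notation`.
-/

set_option autoImplicit false

noncomputable section

open Matrix NumberField NumberField.InfinitePlace
open Literature.NumberTheory.Automorphic Literature.NumberTheory.Automorphic.UnitaryGroup
open Literature.NumberTheory.GelbartRogawski1991 Literature.NumberTheory.GelbartRogawski1991.UnitaryDualPair

namespace HodgeCM.Model.HypCensus

section Frame

variable (L : Type) [Field L] [NumberField L] [IsCMField L] (N : ℕ)

/-- a rational matrix `g ∈ GL_N(L)` read in `GL_N(L ⊗ ℝ)`. -/
def archGLn : GL (Fin N) L →* GL (Fin N) (mixedEmbedding.mixedSpace L) :=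
  Units.map (mixedEmbedding L).mapMatrix.toMonoidHom

omit [NumberField L] [IsCMField L] in
/-- (Ported verbatim from the HodgeCMPerL package; no docstring in the source.) -/
@[simp] theorem val_archGLn (g : GL (Fin N) L) :
    ((archGLn L N g : GL (Fin N) (mixedEmbedding.mixedSpace L)) : Matrix (Fin N) (Fin N) (mixedEmbedding.mixedSpace L)) =
      (g : Matrix (Fin N) (Fin N) L).map (mixedEmbedding L) := rfl

/-- (Ported verbatim from the HodgeCMPerL package; no docstring in the source.) -/
theorem map_conjMixed_map_mixedEmbedding_n (g : Matrix (Fin N) (Fin N) L) :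
    (g.map (mixedEmbedding L)).map (conjMixed (↥(maximalRealSubfield L)) L (IsCMField.complexConj L)) =
      (g.map (Literature.AlgebraicGeometry.ShimuraVarieties.conjRingHomK L)).map (mixedEmbedding L) := by
  rw [Matrix.map_map, Matrix.map_map]
  congr 1
  funext a
  exact conjMixed_mixedEmbedding L a

omit [IsCMField L] in
/-- the archimedean part of `g_𝔸` is `g ⊗ 1`. -/
theorem map_fst_toAdeleGLn (g : GL (Fin N) L) :
    ((Literature.NumberTheory.Automorphic.toAdeleGL L g : GL (Fin N) (AdeleRing (𝓞 L) L)) : Matrix (Fin N) (Fin N) (AdeleRing (𝓞 L) L)).map (adeleFst L) =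
      ((archGLn L N g : GL (Fin N) (mixedEmbedding.mixedSpace L)) : Matrix (Fin N) (Fin N) (mixedEmbedding.mixedSpace L)).map
        (InfiniteAdeleRing.ringEquiv_mixedSpace L).symm.toRingHom := by
  rw [Literature.NumberTheory.Automorphic.val_toAdeleGL, val_archGLn, Matrix.map_map, Matrix.map_map]
  congr 1
  funext a
  change (algebraMap L (AdeleRing (𝓞 L) L) a).1 = (InfiniteAdeleRing.ringEquiv_mixedSpace L).symm (mixedEmbedding L a)
  rw [InfiniteAdeleRing.mixedEmbedding_eq_algebraMap_comp, RingEquiv.symm_apply_apply]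
  rfl

omit [IsCMField L] in
/-- the finite part of `g⁻¹_𝔸` times that of `g_𝔸` is `1`. -/
theorem map_snd_toAdeleGLn_inv_mul (g : GL (Fin N) L) :
    (((Literature.NumberTheory.Automorphic.toAdeleGL L g)⁻¹ : GL (Fin N) (AdeleRing (𝓞 L) L)) : Matrix (Fin N) (Fin N) (AdeleRing (𝓞 L) L)).map (adeleSnd L) *
        ((Literature.NumberTheory.Automorphic.toAdeleGL L g : GL (Fin N) (AdeleRing (𝓞 L) L)) : Matrix (Fin N) (Fin N) (AdeleRing (𝓞 L) L)).map (adeleSnd L) = 1 := by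
  rw [← Matrix.map_mul, ← Units.val_mul, inv_mul_cancel, Units.val_one, Matrix.map_one _ (map_zero _) (map_one _)]

/-- **conjugation by the inverse of a rational frame transports archimedean unitary groups**: `ᵗḡ J g = J'`, `x ∈ U(J)(L⁺ ⊗ ℝ)`
⇒ `g⁻¹ x g ∈ U(J')(L⁺ ⊗ ℝ)`. -/
theorem inv_conj_mem_arch_of_congr (g : GL (Fin N) L) (J J' : Matrix (Fin N) (Fin N) L)
    (hg : ((g : Matrix (Fin N) (Fin N) L).map (Literature.AlgebraicGeometry.ShimuraVarieties.conjRingHomK L))ᵀ * J *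
      (g : Matrix (Fin N) (Fin N) L) = J')
    {x : GL (Fin N) (mixedEmbedding.mixedSpace L)}
    (hx : x ∈ UnitaryGroup.arch (↥(maximalRealSubfield L)) L (IsCMField.complexConj L) N J) :
    (archGLn L N g)⁻¹ * x * archGLn L N g ∈ UnitaryGroup.arch (↥(maximalRealSubfield L)) L (IsCMField.complexConj L) N J' := by
  rw [mem_arch_iff, archFormOf] at hx ⊢
  set m := mixedEmbedding L with hm
  set cM := conjMixed (↥(maximalRealSubfield L)) L (IsCMField.complexConj L) with hcM
  set G : Matrix (Fin N) (Fin N) (mixedEmbedding.mixedSpace L) := (g : Matrix (Fin N) (Fin N) L).map m with hG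
  set Gi : Matrix (Fin N) (Fin N) (mixedEmbedding.mixedSpace L) := ((g⁻¹ : GL (Fin N) L) : Matrix (Fin N) (Fin N) L).map m
    with hGi
  set X : Matrix (Fin N) (Fin N) (mixedEmbedding.mixedSpace L) := (x : Matrix (Fin N) (Fin N) (mixedEmbedding.mixedSpace L))
    with hX
  have hGGi : G * Gi = 1 := by
    rw [hG, hGi, ← Matrix.map_mul, ← Units.val_mul, mul_inv_cancel, Units.val_one, Matrix.map_one _ (map_zero m) (map_one m)]
  have hcong : (G.map cM)ᵀ * J.map m * G = J'.map m := by
    rw [hG, hcM, hm, map_conjMixed_map_mixedEmbedding_n, ← hg, Matrix.map_mul, Matrix.map_mul, Matrix.transpose_map]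
  have h1 : (Gi.map cM)ᵀ * (G.map cM)ᵀ = 1 := by
    rw [← Matrix.transpose_mul, ← Matrix.map_mul, hGGi, Matrix.map_one _ (map_zero cM) (map_one cM), Matrix.transpose_one]
  have hval : (((archGLn L N g)⁻¹ * x * archGLn L N g : GL (Fin N) (mixedEmbedding.mixedSpace L)) :
      Matrix (Fin N) (Fin N) (mixedEmbedding.mixedSpace L)) = Gi * X * G := by
    rw [← map_inv, Units.val_mul, Units.val_mul, val_archGLn, val_archGLn]
  rw [hval, Matrix.map_mul, Matrix.map_mul, Matrix.transpose_mul, Matrix.transpose_mul]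
  calc (G.map cM)ᵀ * ((X.map cM)ᵀ * (Gi.map cM)ᵀ) * J'.map m * (Gi * X * G)
      = (G.map cM)ᵀ * (X.map cM)ᵀ * ((Gi.map cM)ᵀ * (G.map cM)ᵀ) * J.map m * (G * Gi) * X * G := by
        rw [← hcong]; simp only [Matrix.mul_assoc]
    _ = (G.map cM)ᵀ * ((X.map cM)ᵀ * J.map m * X) * G := by
        rw [h1, hGGi, Matrix.mul_one, Matrix.mul_one]; simp only [Matrix.mul_assoc]
    _ = J'.map m := by rw [hx, hcong]

variable (H : Matrix (Fin N) (Fin N) L) (g : GL (Fin N) L) (d : Fin N → L)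
  (hg : ((g : Matrix (Fin N) (Fin N) L).map (cmConjRingHom L))ᵀ * H * (g : Matrix (Fin N) (Fin N) L) = Matrix.diagonal d)

/-- **`k ↦ g⁻¹ k g : U(H)(L⁺ ⊗ ℝ) →* U(diag d)(L⁺ ⊗ ℝ)`** for a rational frame `ᵗḡ H g = diag d`. -/
def archFrameConj :
    ↥(UnitaryGroup.arch (↥(maximalRealSubfield L)) L (IsCMField.complexConj L) N H) →*
      ↥(UnitaryGroup.arch (↥(maximalRealSubfield L)) L (IsCMField.complexConj L) N (Matrix.diagonal d)) where
  toFun k := ⟨(archGLn L N g)⁻¹ * k * archGLn L N g, inv_conj_mem_arch_of_congr L N g H (Matrix.diagonal d) hg k.2⟩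
  map_one' := Subtype.ext (by simp only [OneMemClass.coe_one, mul_one, inv_mul_cancel])
  map_mul' k k' := Subtype.ext (by simp only [Subgroup.coe_mul, mul_assoc, mul_inv_cancel_left])

/-- (Ported verbatim from the HodgeCMPerL package; no docstring in the source.) -/
@[simp] theorem coe_archFrameConj (k : ↥(UnitaryGroup.arch (↥(maximalRealSubfield L)) L (IsCMField.complexConj L) N H)) :
    ((archFrameConj L N H g d hg k : ↥(UnitaryGroup.arch (↥(maximalRealSubfield L)) L (IsCMField.complexConj L) N (Matrix.diagonal d))) :
      GL (Fin N) (mixedEmbedding.mixedSpace L)) = (archGLn L N g)⁻¹ * k * archGLn L N g := rfl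

/-- `archFrameConj` is continuous. -/
theorem continuous_archFrameConj : Continuous (archFrameConj L N H g d hg) :=
  Continuous.subtype_mk ((continuous_mul_const _).comp ((continuous_const_mul _).comp continuous_subtype_val)) _

/-- **the frame transport of an archimedean element is the adelic image of its archimedean conjugate**:
`cmKTypeHom L H g d hg (archToAdelic H k) = archToAdelic (diag d) (g⁻¹ k g)`. -/
theorem cmKTypeHom_archToAdelic (k : ↥(UnitaryGroup.arch (↥(maximalRealSubfield L)) L (IsCMField.complexConj L) N H)) :
    cmKTypeHom L H g d hg (archToAdelic (↥(maximalRealSubfield L)) L (IsCMField.complexConj L) N H k) =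
      archToAdelic (↥(maximalRealSubfield L)) L (IsCMField.complexConj L) N (Matrix.diagonal d) (archFrameConj L N H g d hg k) := by
  apply Subtype.ext
  rw [coe_cmKTypeHom]
  change (Literature.NumberTheory.Automorphic.toAdeleGL L g)⁻¹ * GLn.ofInfinite N L (k : GL (Fin N) (mixedEmbedding.mixedSpace L)) *
      Literature.NumberTheory.Automorphic.toAdeleGL L g =
    GLn.ofInfinite N L ((archGLn L N g)⁻¹ * k * archGLn L N g)
  apply Units.ext
  rw [Units.val_mul, Units.val_mul]
  refine matrix_adele_ext L N ?_ ?_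
  · rw [Matrix.map_mul, Matrix.map_mul, map_fst_ofInfinite, map_fst_ofInfinite, map_fst_toAdeleGLn, ← map_inv, map_fst_toAdeleGLn,
      map_inv, Units.val_mul, Units.val_mul, Matrix.map_mul, Matrix.map_mul]
  · rw [Matrix.map_mul, Matrix.map_mul, map_snd_ofInfinite, map_snd_ofInfinite, Matrix.mul_one, map_snd_toAdeleGLn_inv_mul]

end Frame

/-! ## §2 At the W pin of record: membership in `𝒮^κ` is tested on ARCHIMEDEAN pairs `(g⁻¹ k g, 1)` -/

section Pin

open HodgeCM HodgeCM.Model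

variable {L : CMField} {ι₁ : L →+* ℂ} (V : HermSpace3 L ι₁) (S : StubTree.SeesawDatum L)
variable
  (hGR : (cmSplittingDatum (L : Type) finProdFinEquiv (frameD V) (frameD_real V) (frameD_ne V) (dW S) (dW_real S) (dW_ne S)).CompatibleSplitting)
  (η : CMAdelic (L : Type) (frameD V) × CMAdelic (L : Type) (dW S) →* ℂˣ)
  (hη : ∀ γU ∈ CMRat (L : Type) (frameD V), ∀ γ ∈ CMRat (L : Type) (dW S), η (γU, γ) = 1)
  (hηc : Continuous fun p => ((η p : ℂˣ) : ℂ))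
  (τ : L →+* ℂ) (T : GL (Fin 3) ℂ)
  (hT : formCongr (starRingEnd ℂ) T (V.Hm.map τ) = Literature.Geometry.ComplexHyperbolic.BallModel.J)
  (hV : IsAnisotropic L V.Hm) (h : (∀ j, 0 < (ι₁ (dW S j)).re) ∨ ∀ j, (ι₁ (dW S j)).re < 0)

include hV h in
/-- **membership in `𝒮^κ` at the W pin of record, archimedean form**: `Ψ ∈ W₀.SK` iff for every `k ∈ K_∞`,
`W₀.ρ (archProdHom (frameG⁻¹ k frameG, 1)) Ψ = κ(k) • Ψ` — the input shape of the compact-letter engine. -/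
theorem wmInputCM₂g_mem_SK_iff_arch
    (Ψ : piSchwartzBruhat (wmInputCM₂g V S hGR η hη hηc τ T hT).F (wmInputCM₂g V S hGR η hη hηc τ T hT).ι) :
    Ψ ∈ (wmInputCM₂g V S hGR η hη hηc τ T hT).SK ↔
      ∀ k : ↥(UnitaryGroup.archIsotropy (L : Type) V.Hm τ T hT),
        (((wmInputCM₂g V S hGR η hη hηc τ T hT).ρ
            (archProdHom (↥(maximalRealSubfield L)) (L : Type) (IsCMField.complexConj L) 3 2 (Matrix.diagonal (frameD V))
              (Matrix.diagonal (dW S))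
              (archFrameConj (L : Type) 3 V.Hm (frameG V) (frameD V) (frame_congr V)
                  (k : ↥(UnitaryGroup.arch (↥(maximalRealSubfield L)) (L : Type) (IsCMField.complexConj L) 3 V.Hm)),
                (1 : ↥(UnitaryGroup.arch (↥(maximalRealSubfield L)) (L : Type) (IsCMField.complexConj L) 2 (Matrix.diagonal (dW S))))))) :
            Module.End ℂ (piSchwartzBruhat (wmInputCM₂g V S hGR η hη hηc τ T hT).F (wmInputCM₂g V S hGR η hη hηc τ T hT).ι)) Ψ =
          ((UnitaryGroup.archKappa (L : Type) V.Hm τ T hT k : ℂˣ) : ℂ) • Ψ := by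
  rw [wmInputCM₂g_mem_SK_iff V S hGR η hη hηc τ T hT hV h Ψ]
  refine forall_congr' fun k => ?_
  rw [wmInputCM₂g_eV_archIsotropyRegime]
  change ((wmInputCM₂g V S hGR η hη hηc τ T hT).ρ
      (cmKTypeHom (L : Type) V.Hm (frameG V) (frameD V) (frame_congr V)
        (archToAdelic (↥(maximalRealSubfield L)) (L : Type) (IsCMField.complexConj L) 3 V.Hm
          (k : ↥(UnitaryGroup.arch (↥(maximalRealSubfield L)) (L : Type) (IsCMField.complexConj L) 3 V.Hm))), 1) :
      Module.End ℂ (piSchwartzBruhat (wmInputCM₂g V S hGR η hη hηc τ T hT).F (wmInputCM₂g V S hGR η hη hηc τ T hT).ι)) Ψ = _ ↔ _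
  rw [cmKTypeHom_archToAdelic]
  have hp : Prod.mk (archToAdelic (↥(maximalRealSubfield L)) (L : Type) (IsCMField.complexConj L) 3 (Matrix.diagonal (frameD V))
        (archFrameConj (L : Type) 3 V.Hm (frameG V) (frameD V) (frame_congr V)
          (k : ↥(UnitaryGroup.arch (↥(maximalRealSubfield L)) (L : Type) (IsCMField.complexConj L) 3 V.Hm))))
        (1 : CMAdelic (L : Type) (dW S)) =
      archProdHom (↥(maximalRealSubfield L)) (L : Type) (IsCMField.complexConj L) 3 2 (Matrix.diagonal (frameD V))
        (Matrix.diagonal (dW S))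
        (Prod.mk (archFrameConj (L : Type) 3 V.Hm (frameG V) (frameD V) (frame_congr V)
            (k : ↥(UnitaryGroup.arch (↥(maximalRealSubfield L)) (L : Type) (IsCMField.complexConj L) 3 V.Hm)))
          (1 : ↥(UnitaryGroup.arch (↥(maximalRealSubfield L)) (L : Type) (IsCMField.complexConj L) 2 (Matrix.diagonal (dW S))))) :=
    Prod.ext rfl (show (1 : CMAdelic (L : Type) (dW S)) =
      archToAdelic (↥(maximalRealSubfield L)) (L : Type) (IsCMField.complexConj L) 2 (Matrix.diagonal (dW S)) 1 from (map_one _).symm)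
  exact Iff.of_eq (congrArg (fun q => (((wmInputCM₂g V S hGR η hη hηc τ T hT).ρ q :
    Module.End ℂ (piSchwartzBruhat (wmInputCM₂g V S hGR η hη hηc τ T hT).F (wmInputCM₂g V S hGR η hη hηc τ T hT).ι)) Ψ =
      ((UnitaryGroup.archKappa (L : Type) V.Hm τ T hT k : ℂˣ) : ℂ) • Ψ)) hp)

end Pin

end HodgeCM.Model.HypCensus

end
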